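import Summits.CriticalPhenomena.Ising3DConformalLimit.Theorems.SubPtolemyInterlacingSubPtolemyFloorSteinCovariance
import Summits.CriticalPhenomena.Ising3DConformalLimit.Theorems.SubPtolemyInterlacingSubPtolemyFloorPlusCauchySchwarz
import HarnessLib

/-!
# Stein witnesses for `SubPtolemyFloor`: the diagonal of the Stein structure factor and the
# majorant obstruction (line `Sketch` = crux idea `stein-cramer-rao-dual-witness`,
# crux stmt-CriticalPhenomena-15703)

Notation as in `…SubPtolemyFloorSteinCertificate`: `⟨·⟩ = plusExpect d β 0` (`β ≥ 0`; the crux uses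
`d = 3`, `β = criticalBeta 3`), `S_x σ = ∑ y ∈ (zdGraph d).neighborFinset x, spinAt y σ`,
`t_x = tanh(β S_x)`, DLR score `g_x = σ_x − t_x`, local `A` reading the finite `K ∌ 0`,
`A_x σ = A (σ(· + x))`, Stein field `Ψ^A_x = A_x g_x`, coupling `c_A = ⟨A(1 − t_0²)⟩`.

The registered engine stub of the line asks for witnesses `A = A_r` at every scale `r` whose block
variance `V_A(r) = Σ_{x,y∈Λ_r} ⟨Ψ^A_xΨ^A_y⟩` is SMALL: `≤ C |Λ_r| r^{-b} c_A²` with `b > 1.834`. This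
file records, kernel-checked, why no TERM-WISE (majorant) estimate of the local covariances
`⟨Ψ^A_xΨ^A_y⟩` — the production route named by the card ("Newman's Gaussian inequality + the infrared
bound as majorants, GKS for `c_A`") — can certify that for ANY `b > 0`:

* `plusExpect_steinField_sq` — the DIAGONAL of the Stein structure factor is explicit:
  `⟨(Ψ^A_x)²⟩ = ⟨A²(1 − t_0²)⟩` for every `x` (heat bath: `E[g_x² | σ_{≠x}] = 1 − t_x²`; translation
  invariance);
* `coupling_sq_le_plusExpect_sq_mul` — `c_A² ≤ ⟨A²(1 − t_0²)⟩` (Cauchy–Schwarz with the weight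
  `1 − t_0² ≤ 1`), i.e. `c_A² ≤ ⟨(Ψ^A_0)²⟩`: each diagonal term ALONE is at least `c_A²`;
* `stub_steinMajorantObstruction` (registered) — hence
  `|Λ_r| · c_A² ≤ Σ_{x∈Λ_r} ⟨(Ψ^A_x)²⟩ ≤ Σ_{x,y∈Λ_r} |⟨Ψ^A_xΨ^A_y⟩|` for EVERY local `A` and every `r`:
  any bound of the block variance by the sum of absolute values of the local covariances is
  `≥ |Λ_r| c_A²`, so it can certify `V_A(r) ≤ C|Λ_r| r^{-b} c_A²` only while `C r^{-b} ≥ 1`, i.e. never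
  with `b > 0` beyond the scale `r = C^{1/b}`. A Stein witness with `b > 0` is therefore a
  CANCELLATION statement — the off-diagonal covariances must cancel the (positive, `≥ |Λ_r| c_A²`)
  diagonal to relative order `r^{-b}` (near-hyperuniformity of the Stein field) — which majorants
  (IR, Newman/Lebowitz, GKS: all one-sided bounds on `|⟨Ψ_xΨ_y⟩|`) cannot express.

* `stub_steinOffdiagCancellation` (registered; appended by lead c4 after `p151778`) — the SIGNED form:
  a witness at scale `r` must have `Σ_{x≠y∈Λ_r} ⟨Ψ^A_xΨ^A_y⟩ ≤ (C r^{-b} − 1)|Λ_r| c_A²` — negative total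
  off-diagonal covariance cancelling the diagonal to precision `r^{-b}` (`plusExpect_steinSum_sq_eq_sum_sum`:
  `V_A(r) = Σ_{x,y}⟨Ψ_xΨ_y⟩`).

No definitions, no named facts, 0 sorries. General `d`, `β ≥ 0` except the registered stubs (`d = 3`, `β_c`).
-/

noncomputable section

namespace Summit.CriticalPhenomena.Ising3DConformalLimit.SubPtolemyFloorStein

open scoped BigOperators Classical
open Finset MeasureTheory Literature.Probability.LatticeModels

/-! ### The diagonal of the Stein structure factor -/

/-- Linearity: `⟨F − G⟩⁺_{β,h} = ⟨F⟩⁺_{β,h} − ⟨G⟩⁺_{β,h}` for local `F`, `G` (`β ≥ 0`). [folklore] -/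
theorem win_plusExpect_sub {d : ℕ} {β : ℝ} (hβ : 0 ≤ β) (h : ℝ) {D₁ D₂ : Finset (Site d)}
    {F G : SpinConfig (Site d) → ℝ} (hF : DependsOn F (↑D₁ : Set (Site d)))
    (hG : DependsOn G (↑D₂ : Set (Site d))) :
    plusExpect d β h (fun σ => F σ - G σ) = plusExpect d β h F - plusExpect d β h G := by
  obtain ⟨μ, _, -, -, -, hμE⟩ := exists_plusMeasure_integral_eq_plusExpect (d := d) hβ h
  rw [hμE _ _ (cov_dependsOn_sub hF hG), hμE _ _ hF, hμE _ _ hG,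
    integral_sub (integrable_of_dependsOn_finset μ _ hF) (integrable_of_dependsOn_finset μ _ hG)]

/-- `x ∉ (neighbours of x) ∪ (K + x)` when `0 ∉ K` (no loops in `ℤ^d`). [folklore] -/
theorem win_notMem_nbrs_union_image {d : ℕ} {K : Finset (Site d)} (hK : (0 : Site d) ∉ K)
    (x : Site d) : x ∉ (zdGraph d).neighborFinset x ∪ K.image (· + x) := fun h => by
  rcases Finset.mem_union.1 h with h | h
  · exact SimpleGraph.irrefl _ ((SimpleGraph.mem_neighborFinset _ _ _).1 h)
  · obtain ⟨k, hk, hkx⟩ := Finset.mem_image.1 h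
    have hkx : k + x = x := hkx
    rw [add_eq_right.1 hkx] at hk
    exact hK hk

/-- **The diagonal of the Stein structure factor.** For `β ≥ 0`, a local `A` reading `K ∌ 0` and any
site `x`: `⟨(Ψ^A_x)²⟩⁺_{β,0} = ⟨A² (1 − tanh(β S_0)²)⟩⁺_{β,0}`. Pointwise
`(A_x g_x)² = σ_x · (A_x² g_x) − (t_x A_x²) · g_x`; the first term is the diagonal term of the
covariance identity for the functional `A²` (`cov_diag`: heat bath + translation invariance), the
second is a DLR score against a functional not reading `σ_x`, hence `0` (`plusExpect_score_mul_eq_zero`).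
Informally: `E[g_x² | σ_{≠x}] = Var(σ_x | σ_{≠x}) = 1 − t_x²`. [folklore] -/
theorem plusExpect_steinField_sq {d : ℕ} {β : ℝ} (hβ : 0 ≤ β) {K : Finset (Site d)}
    {A : SpinConfig (Site d) → ℝ} (hK : (0 : Site d) ∉ K) (hA : DependsOn A (↑K : Set (Site d)))
    (x : Site d) :
    plusExpect d β 0 (fun σ => (A (fun z => σ (z + x)) *
        (spinAt x σ - Real.tanh (β * ∑ w ∈ (zdGraph d).neighborFinset x, spinAt w σ))) ^ 2) =
      plusExpect d β 0 (fun σ => A σ ^ 2 *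
        (1 - Real.tanh (β * ∑ w ∈ (zdGraph d).neighborFinset 0, spinAt w σ) ^ 2)) := by
  have hA2 : DependsOn (fun σ : SpinConfig (Site d) => A σ ^ 2) (↑K : Set (Site d)) :=
    cs_dependsOn_sq hA
  -- the two pieces
  have h1 := cov_diag hβ hK hA2 x
  have hg : DependsOn (fun σ : SpinConfig (Site d) =>
      Real.tanh (β * ∑ w ∈ (zdGraph d).neighborFinset x, spinAt w σ) * A (fun z => σ (z + x)) ^ 2)
      (↑((zdGraph d).neighborFinset x ∪ K.image (· + x)) : Set (Site d)) :=
    cov_dependsOn_mul (cov_dependsOn_tanh β x) (dependsOn_comp_add K hA2 x)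
  have h2 := plusExpect_score_mul_eq_zero hβ x hg (win_notMem_nbrs_union_image hK x)
  -- supports, for linearity
  have hF : DependsOn (fun σ : SpinConfig (Site d) => spinAt x σ * (A (fun z => σ (z + x)) ^ 2 *
      (spinAt x σ - Real.tanh (β * ∑ w ∈ (zdGraph d).neighborFinset x, spinAt w σ))))
      (↑({x} ∪ (K.image (· + x) ∪ ({x} ∪ (zdGraph d).neighborFinset x))) : Set (Site d)) :=
    cov_dependsOn_mul (cov_dependsOn_spinAt x) (cov_dependsOn_mul (dependsOn_comp_add K hA2 x)
      (cov_dependsOn_sub (cov_dependsOn_spinAt x) (cov_dependsOn_tanh β x)))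
  have hG : DependsOn (fun σ : SpinConfig (Site d) =>
      (spinAt x σ - Real.tanh (β * ∑ w ∈ (zdGraph d).neighborFinset x, spinAt w σ)) *
        (Real.tanh (β * ∑ w ∈ (zdGraph d).neighborFinset x, spinAt w σ) * A (fun z => σ (z + x)) ^ 2))
      (↑(({x} ∪ (zdGraph d).neighborFinset x) ∪ ((zdGraph d).neighborFinset x ∪ K.image (· + x))) :
        Set (Site d)) :=
    cov_dependsOn_mul (cov_dependsOn_sub (cov_dependsOn_spinAt x) (cov_dependsOn_tanh β x)) hg
  -- pointwise decomposition `(A_x g_x)² = A_x² g_x (σ_x − t_x) = σ_x (A_x² g_x) − g_x (t_x A_x²)`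
  have e : (fun σ : SpinConfig (Site d) => (A (fun z => σ (z + x)) *
        (spinAt x σ - Real.tanh (β * ∑ w ∈ (zdGraph d).neighborFinset x, spinAt w σ))) ^ 2) =
      fun σ => spinAt x σ * (A (fun z => σ (z + x)) ^ 2 *
          (spinAt x σ - Real.tanh (β * ∑ w ∈ (zdGraph d).neighborFinset x, spinAt w σ))) -
        (spinAt x σ - Real.tanh (β * ∑ w ∈ (zdGraph d).neighborFinset x, spinAt w σ)) *
          (Real.tanh (β * ∑ w ∈ (zdGraph d).neighborFinset x, spinAt w σ) *
            A (fun z => σ (z + x)) ^ 2) := by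
    funext σ
    ring
  rw [e, win_plusExpect_sub hβ 0 hF hG, h1, h2, sub_zero]

/-! ### The coupling is dominated by the diagonal -/

/-- `⟨F⟩⁺_{β,0} ≤ 1` for a local `F ≤ 1`, and `0 ≤ ⟨F⟩⁺_{β,0}` for a local `F ≥ 0` (`β ≥ 0`). [folklore] -/
theorem win_plusExpect_le_one_and_nonneg {d : ℕ} {β : ℝ} (hβ : 0 ≤ β) {D : Finset (Site d)}
    {F : SpinConfig (Site d) → ℝ} (hF : DependsOn F (↑D : Set (Site d))) :
    ((∀ σ, F σ ≤ 1) → plusExpect d β 0 F ≤ 1) ∧ ((∀ σ, 0 ≤ F σ) → 0 ≤ plusExpect d β 0 F) := by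
  obtain ⟨μ, hμP, -, -, -, hμE⟩ := exists_plusMeasure_integral_eq_plusExpect (d := d) hβ 0
  rw [hμE _ _ hF]
  refine ⟨fun h1 => ?_, fun h0 => integral_nonneg h0⟩
  calc ∫ σ, F σ ∂μ ≤ ∫ _σ, (1 : ℝ) ∂μ :=
        integral_mono (integrable_of_dependsOn_finset μ _ hF) (integrable_const 1) h1
    _ = 1 := by simp

/-- **`c_A² ≤ ⟨A²(1 − t_0²)⟩ = ⟨(Ψ^A_0)²⟩`**: Cauchy–Schwarz `⟨A w · w⟩² ≤ ⟨A² w²⟩⟨w²⟩` with the weight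
`w = √(1 − t_0²)`, and `⟨w²⟩ = ⟨1 − t_0²⟩ ≤ 1`. The coupling of a Stein witness never exceeds the
square root of ONE diagonal term of its structure factor. [folklore] -/
theorem coupling_sq_le_plusExpect_sq_mul {d : ℕ} {β : ℝ} (hβ : 0 ≤ β) {K : Finset (Site d)}
    {A : SpinConfig (Site d) → ℝ} (hA : DependsOn A (↑K : Set (Site d))) :
    plusExpect d β 0 (fun σ => A σ *
        (1 - Real.tanh (β * ∑ w ∈ (zdGraph d).neighborFinset 0, spinAt w σ) ^ 2)) ^ 2 ≤
      plusExpect d β 0 (fun σ => A σ ^ 2 *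
        (1 - Real.tanh (β * ∑ w ∈ (zdGraph d).neighborFinset 0, spinAt w σ) ^ 2)) := by
  -- the weight and its square
  set t : SpinConfig (Site d) → ℝ := fun σ =>
    Real.tanh (β * ∑ w ∈ (zdGraph d).neighborFinset 0, spinAt w σ) with ht
  have ht1 : ∀ σ, 0 ≤ 1 - t σ ^ 2 := fun σ => by
    have := Real.abs_tanh_lt_one (β * ∑ w ∈ (zdGraph d).neighborFinset 0, spinAt w σ)
    have h2 : t σ ^ 2 < 1 := by
      rw [ht]; exact (sq_lt_one_iff_abs_lt_one _).2 this
    linarith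
  have hwt : DependsOn t (↑((zdGraph d).neighborFinset 0) : Set (Site d)) := cov_dependsOn_tanh β 0
  have hw : DependsOn (fun σ => Real.sqrt (1 - t σ ^ 2))
      (↑((zdGraph d).neighborFinset 0) : Set (Site d)) := fun σ τ hst => by
    dsimp only
    rw [hwt hst]
  have hsq : ∀ σ, Real.sqrt (1 - t σ ^ 2) ^ 2 = 1 - t σ ^ 2 := fun σ => Real.sq_sqrt (ht1 σ)
  -- Cauchy–Schwarz with `f = A w`, `g = w`
  have hCS := stub_plusCauchySchwarz d β hβ (K ∪ (zdGraph d).neighborFinset 0)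
    ((zdGraph d).neighborFinset 0) (fun σ => A σ * Real.sqrt (1 - t σ ^ 2))
    (fun σ => Real.sqrt (1 - t σ ^ 2)) (cov_dependsOn_mul hA hw) hw
  have e1 : (fun σ => A σ * Real.sqrt (1 - t σ ^ 2) * Real.sqrt (1 - t σ ^ 2)) =
      fun σ => A σ * (1 - t σ ^ 2) := by
    funext σ; rw [mul_assoc, ← sq, hsq]
  have e2 : (fun σ => (A σ * Real.sqrt (1 - t σ ^ 2)) ^ 2) = fun σ => A σ ^ 2 * (1 - t σ ^ 2) := by
    funext σ; rw [mul_pow, hsq]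
  have e3 : (fun σ => Real.sqrt (1 - t σ ^ 2) ^ 2) = fun σ => 1 - t σ ^ 2 := funext hsq
  rw [e1, e2, e3] at hCS
  -- `⟨1 − t²⟩ ≤ 1` and `⟨A²(1 − t²)⟩ ≥ 0`
  have hone : plusExpect d β 0 (fun σ => 1 - t σ ^ 2) ≤ 1 :=
    (win_plusExpect_le_one_and_nonneg hβ (cov_dependsOn_sub
      (show DependsOn (fun _ : SpinConfig (Site d) => (1 : ℝ)) (↑(∅ : Finset (Site d)) : Set (Site d))
        from fun _ _ _ => rfl) (cs_dependsOn_sq hwt))).1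
      fun σ => by linarith [sq_nonneg (t σ)]
  have hnn : 0 ≤ plusExpect d β 0 (fun σ => A σ ^ 2 * (1 - t σ ^ 2)) :=
    (win_plusExpect_le_one_and_nonneg hβ (cov_dependsOn_mul (cs_dependsOn_sq hA)
      (cov_dependsOn_sub (show DependsOn (fun _ : SpinConfig (Site d) => (1 : ℝ))
        (↑(∅ : Finset (Site d)) : Set (Site d)) from fun _ _ _ => rfl) (cs_dependsOn_sq hwt)))).2
      fun σ => mul_nonneg (sq_nonneg _) (ht1 σ)
  calc plusExpect d β 0 (fun σ => A σ * (1 - t σ ^ 2)) ^ 2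
      ≤ plusExpect d β 0 (fun σ => A σ ^ 2 * (1 - t σ ^ 2)) *
          plusExpect d β 0 (fun σ => 1 - t σ ^ 2) := hCS
    _ ≤ plusExpect d β 0 (fun σ => A σ ^ 2 * (1 - t σ ^ 2)) * 1 :=
        mul_le_mul_of_nonneg_left hone hnn
    _ = _ := mul_one _

/-! ### The majorant obstruction (registered stub) -/

/-- **Registered stub `stub_steinMajorantObstruction` — the majorant obstruction to the engine of the
line `Sketch`.** For every local functional `A` not reading `σ_0` and every scale `r`,
`|Λ_r| · c_A² ≤ Σ_{x,y∈Λ_r} |⟨Ψ^A_x Ψ^A_y⟩_{β_c(3)}|`: the diagonal terms alone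
(`⟨(Ψ^A_x)²⟩ = ⟨A²(1−t_0²)⟩ ≥ c_A²`, `plusExpect_steinField_sq`, `coupling_sq_le_plusExpect_sq_mul`)
exhaust the engine's budget `C |Λ_r| r^{-b} c_A²` as soon as `C r^{-b} < 1`. Consequently the
variance bound asked by the engine stub `stub_steinWitness` (any `b > 0`) can never be certified by
bounding the local covariances `⟨Ψ^A_xΨ^A_y⟩` one by one in absolute value (IR / Newman–Lebowitz /
GKS majorants): it is a cancellation (near-hyperuniformity) statement about the Stein field. [folklore] -/
theorem stub_steinMajorantObstruction :
    ∀ (K : Finset (Site 3)) (A : SpinConfig (Site 3) → ℝ), (0 : Site 3) ∉ K →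
      DependsOn A (↑K : Set (Site 3)) → ∀ r : ℕ,
        (#(box 3 r) : ℝ) * plusExpect 3 (criticalBeta 3) 0 (fun σ => A σ *
            (1 - Real.tanh (criticalBeta 3 *
              ∑ y ∈ (zdGraph 3).neighborFinset 0, spinAt y σ) ^ 2)) ^ 2 ≤
          ∑ x ∈ box 3 r, ∑ y ∈ box 3 r, |plusExpect 3 (criticalBeta 3) 0 (fun σ =>
            (A (fun z => σ (z + x)) * (spinAt x σ - Real.tanh (criticalBeta 3 *
                ∑ w ∈ (zdGraph 3).neighborFinset x, spinAt w σ))) *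
            (A (fun z => σ (z + y)) * (spinAt y σ - Real.tanh (criticalBeta 3 *
                ∑ w ∈ (zdGraph 3).neighborFinset y, spinAt w σ))))| := by
  intro K A hK hA r
  have hβ := criticalBeta_nonneg 3
  set cA := plusExpect 3 (criticalBeta 3) 0 (fun σ => A σ *
    (1 - Real.tanh (criticalBeta 3 * ∑ y ∈ (zdGraph 3).neighborFinset 0, spinAt y σ) ^ 2)) with hcA
  -- each diagonal term is `⟨A²(1−t_0²)⟩ ≥ c_A²`
  have hdiag : ∀ x ∈ box 3 r, cA ^ 2 ≤ |plusExpect 3 (criticalBeta 3) 0 (fun σ =>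
      (A (fun z => σ (z + x)) * (spinAt x σ - Real.tanh (criticalBeta 3 *
          ∑ w ∈ (zdGraph 3).neighborFinset x, spinAt w σ))) *
      (A (fun z => σ (z + x)) * (spinAt x σ - Real.tanh (criticalBeta 3 *
          ∑ w ∈ (zdGraph 3).neighborFinset x, spinAt w σ))))| := by
    intro x _
    have e : (fun σ : SpinConfig (Site 3) =>
        (A (fun z => σ (z + x)) * (spinAt x σ - Real.tanh (criticalBeta 3 *
            ∑ w ∈ (zdGraph 3).neighborFinset x, spinAt w σ))) *
        (A (fun z => σ (z + x)) * (spinAt x σ - Real.tanh (criticalBeta 3 *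
            ∑ w ∈ (zdGraph 3).neighborFinset x, spinAt w σ)))) =
        fun σ => (A (fun z => σ (z + x)) * (spinAt x σ - Real.tanh (criticalBeta 3 *
            ∑ w ∈ (zdGraph 3).neighborFinset x, spinAt w σ))) ^ 2 := by
      funext σ; ring
    rw [e, plusExpect_steinField_sq hβ hK hA x]
    exact (coupling_sq_le_plusExpect_sq_mul hβ hA).trans (le_abs_self _)
  -- keep only the diagonal of the double sum
  calc (#(box 3 r) : ℝ) * cA ^ 2 = ∑ x ∈ box 3 r, cA ^ 2 := by
        rw [Finset.sum_const, nsmul_eq_mul]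
    _ ≤ ∑ x ∈ box 3 r, |plusExpect 3 (criticalBeta 3) 0 (fun σ =>
            (A (fun z => σ (z + x)) * (spinAt x σ - Real.tanh (criticalBeta 3 *
                ∑ w ∈ (zdGraph 3).neighborFinset x, spinAt w σ))) *
            (A (fun z => σ (z + x)) * (spinAt x σ - Real.tanh (criticalBeta 3 *
                ∑ w ∈ (zdGraph 3).neighborFinset x, spinAt w σ))))| :=
        Finset.sum_le_sum hdiag
    _ ≤ _ := Finset.sum_le_sum fun x hx => Finset.single_le_sum (f := fun y =>
          |plusExpect 3 (criticalBeta 3) 0 (fun σ =>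
            (A (fun z => σ (z + x)) * (spinAt x σ - Real.tanh (criticalBeta 3 *
                ∑ w ∈ (zdGraph 3).neighborFinset x, spinAt w σ))) *
            (A (fun z => σ (z + y)) * (spinAt y σ - Real.tanh (criticalBeta 3 *
                ∑ w ∈ (zdGraph 3).neighborFinset y, spinAt w σ))))|)
          (fun y _ => abs_nonneg _) hx

/-! ### Necessary near-hyperuniformity of a Stein witness (registered stub) -/

/-- The block second moment of the Stein field is the double sum of its local covariances:
`V_A(r) = ⟨(Σ_{x∈Λ_r} Ψ^A_x)²⟩ = Σ_{x,y∈Λ_r} ⟨Ψ^A_x Ψ^A_y⟩` (linearity of the plus state on local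
observables). [folklore] -/
theorem plusExpect_steinSum_sq_eq_sum_sum {d : ℕ} {β : ℝ} (hβ : 0 ≤ β) {K : Finset (Site d)}
    {A : SpinConfig (Site d) → ℝ} (hA : DependsOn A (↑K : Set (Site d))) (r : ℕ) :
    plusExpect d β 0 (fun σ => (∑ x ∈ box d r, A (fun z => σ (z + x)) *
        (spinAt x σ - Real.tanh (β * ∑ w ∈ (zdGraph d).neighborFinset x, spinAt w σ))) ^ 2) =
      ∑ x ∈ box d r, ∑ y ∈ box d r, plusExpect d β 0 (fun σ =>
        (A (fun z => σ (z + x)) * (spinAt x σ - Real.tanh (β *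
            ∑ w ∈ (zdGraph d).neighborFinset x, spinAt w σ))) *
        (A (fun z => σ (z + y)) * (spinAt y σ - Real.tanh (β *
            ∑ w ∈ (zdGraph d).neighborFinset y, spinAt w σ)))) := by
  -- support of one Stein field `Ψ_x`
  have hΨ : ∀ x : Site d, DependsOn (fun σ : SpinConfig (Site d) => A (fun z => σ (z + x)) *
      (spinAt x σ - Real.tanh (β * ∑ w ∈ (zdGraph d).neighborFinset x, spinAt w σ)))
      (↑(K.image (· + x) ∪ ({x} ∪ (zdGraph d).neighborFinset x)) : Set (Site d)) := fun x =>
    cov_dependsOn_mul (dependsOn_comp_add K hA x)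
      (cov_dependsOn_sub (cov_dependsOn_spinAt x) (cov_dependsOn_tanh β x))
  have e : (fun σ : SpinConfig (Site d) => (∑ x ∈ box d r, A (fun z => σ (z + x)) *
        (spinAt x σ - Real.tanh (β * ∑ w ∈ (zdGraph d).neighborFinset x, spinAt w σ))) ^ 2) =
      fun σ => ∑ x ∈ box d r, ∑ y ∈ box d r,
        (A (fun z => σ (z + x)) * (spinAt x σ - Real.tanh (β *
            ∑ w ∈ (zdGraph d).neighborFinset x, spinAt w σ))) *
        (A (fun z => σ (z + y)) * (spinAt y σ - Real.tanh (β *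
            ∑ w ∈ (zdGraph d).neighborFinset y, spinAt w σ))) := by
    funext σ
    rw [sq, Finset.sum_mul_sum]
  rw [e, cov_plusExpect_finset_sum hβ 0 (box d r)
    (fun x => (box d r).biUnion fun y => (K.image (· + x) ∪ ({x} ∪ (zdGraph d).neighborFinset x)) ∪
      (K.image (· + y) ∪ ({y} ∪ (zdGraph d).neighborFinset y))) _
    (fun x _ => cov_dependsOn_finset_sum (box d r) _ fun y _ => cov_dependsOn_mul (hΨ x) (hΨ y))]
  exact Finset.sum_congr rfl fun x _ => cov_plusExpect_finset_sum hβ 0 (box d r) _ _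
    fun y _ => cov_dependsOn_mul (hΨ x) (hΨ y)

/-- **Registered stub `stub_steinOffdiagCancellation` — a Stein witness is necessarily
near-hyperuniform.** If a local `A` (reading `K ∌ 0`) satisfies the engine's variance bound at scale
`r`, `V_A(r) ≤ C |Λ_r| r^{-b} c_A²`, then its OFF-DIAGONAL Stein covariances are negative in total and
cancel the diagonal up to the relative error `C r^{-b}`:
`Σ_{x∈Λ_r} Σ_{y∈Λ_r, y≠x} ⟨Ψ^A_xΨ^A_y⟩ ≤ (C r^{-b} − 1) |Λ_r| c_A²` (because `V_A(r) = Σ_{x,y}⟨Ψ_xΨ_y⟩`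
and each diagonal term is `⟨A²(1−t_0²)⟩ ≥ c_A²`). For `b > 0` and `r > C^{1/b}` the right side is
negative: producing a witness means PROVING cancellation between the diagonal and the off-diagonal
part of the Stein structure factor to precision `r^{-b}` — a two-sided statement no one-sided
correlation inequality (GKS, Lebowitz/Newman, infrared bound) can deliver. [folklore] -/
theorem stub_steinOffdiagCancellation :
    ∀ (K : Finset (Site 3)) (A : SpinConfig (Site 3) → ℝ), (0 : Site 3) ∉ K →
      DependsOn A (↑K : Set (Site 3)) → ∀ (r : ℕ) (C b : ℝ),
        plusExpect 3 (criticalBeta 3) 0 (fun σ => (∑ x ∈ box 3 r, A (fun y => σ (y + x)) *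
            (spinAt x σ - Real.tanh (criticalBeta 3 *
              ∑ y ∈ (zdGraph 3).neighborFinset x, spinAt y σ))) ^ 2) ≤
          C * (#(box 3 r) : ℝ) * (r : ℝ) ^ (-b) *
            plusExpect 3 (criticalBeta 3) 0 (fun σ => A σ *
              (1 - Real.tanh (criticalBeta 3 *
                ∑ y ∈ (zdGraph 3).neighborFinset 0, spinAt y σ) ^ 2)) ^ 2 →
        ∑ x ∈ box 3 r, ∑ y ∈ (box 3 r).erase x, plusExpect 3 (criticalBeta 3) 0 (fun σ =>
            (A (fun z => σ (z + x)) * (spinAt x σ - Real.tanh (criticalBeta 3 *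
                ∑ w ∈ (zdGraph 3).neighborFinset x, spinAt w σ))) *
            (A (fun z => σ (z + y)) * (spinAt y σ - Real.tanh (criticalBeta 3 *
                ∑ w ∈ (zdGraph 3).neighborFinset y, spinAt w σ)))) ≤
          (C * (r : ℝ) ^ (-b) - 1) * (#(box 3 r) : ℝ) *
            plusExpect 3 (criticalBeta 3) 0 (fun σ => A σ *
              (1 - Real.tanh (criticalBeta 3 *
                ∑ y ∈ (zdGraph 3).neighborFinset 0, spinAt y σ) ^ 2)) ^ 2 := by
  intro K A hK hA r C b hV
  have hβ := criticalBeta_nonneg 3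
  set cA := plusExpect 3 (criticalBeta 3) 0 (fun σ => A σ *
    (1 - Real.tanh (criticalBeta 3 * ∑ y ∈ (zdGraph 3).neighborFinset 0, spinAt y σ) ^ 2)) with hcA
  -- the local covariance of `Ψ_x` and `Ψ_y`
  set Cov : Site 3 → Site 3 → ℝ := fun x y => plusExpect 3 (criticalBeta 3) 0 (fun σ =>
      (A (fun z => σ (z + x)) * (spinAt x σ - Real.tanh (criticalBeta 3 *
          ∑ w ∈ (zdGraph 3).neighborFinset x, spinAt w σ))) *
      (A (fun z => σ (z + y)) * (spinAt y σ - Real.tanh (criticalBeta 3 *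
          ∑ w ∈ (zdGraph 3).neighborFinset y, spinAt w σ)))) with hCov
  -- `V = Σ_x Σ_y Cov x y`
  have hVsum := plusExpect_steinSum_sq_eq_sum_sum hβ hA r
  -- diagonal terms `Cov x x = ⟨A²(1−t_0²)⟩ ≥ c_A²`
  have hdiag : ∀ x, cA ^ 2 ≤ Cov x x := fun x => by
    have e : (fun σ : SpinConfig (Site 3) =>
        (A (fun z => σ (z + x)) * (spinAt x σ - Real.tanh (criticalBeta 3 *
            ∑ w ∈ (zdGraph 3).neighborFinset x, spinAt w σ))) *
        (A (fun z => σ (z + x)) * (spinAt x σ - Real.tanh (criticalBeta 3 *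
            ∑ w ∈ (zdGraph 3).neighborFinset x, spinAt w σ)))) =
        fun σ => (A (fun z => σ (z + x)) * (spinAt x σ - Real.tanh (criticalBeta 3 *
            ∑ w ∈ (zdGraph 3).neighborFinset x, spinAt w σ))) ^ 2 := by
      funext σ; ring
    show cA ^ 2 ≤ plusExpect 3 (criticalBeta 3) 0 _
    rw [e, plusExpect_steinField_sq hβ hK hA x]
    exact coupling_sq_le_plusExpect_sq_mul hβ hA
  -- split each inner sum into the diagonal term and the rest
  have hsplit : ∀ x ∈ box 3 r, ∑ y ∈ box 3 r, Cov x y = Cov x x + ∑ y ∈ (box 3 r).erase x, Cov x y :=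
    fun x hx => (Finset.add_sum_erase _ _ hx).symm
  have hV' : ∑ x ∈ box 3 r, (Cov x x + ∑ y ∈ (box 3 r).erase x, Cov x y) ≤
      C * (#(box 3 r) : ℝ) * (r : ℝ) ^ (-b) * cA ^ 2 := by
    rw [← Finset.sum_congr rfl hsplit]
    have h := hV
    rw [hVsum] at h
    exact h
  rw [Finset.sum_add_distrib] at hV'
  have hD : (#(box 3 r) : ℝ) * cA ^ 2 ≤ ∑ x ∈ box 3 r, Cov x x := by
    calc (#(box 3 r) : ℝ) * cA ^ 2 = ∑ x ∈ box 3 r, cA ^ 2 := by rw [Finset.sum_const, nsmul_eq_mul]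
      _ ≤ ∑ x ∈ box 3 r, Cov x x := Finset.sum_le_sum fun x _ => hdiag x
  show ∑ x ∈ box 3 r, ∑ y ∈ (box 3 r).erase x, Cov x y ≤ (C * (r : ℝ) ^ (-b) - 1) * (#(box 3 r) : ℝ) * cA ^ 2
  nlinarith [hV', hD]

end Summit.CriticalPhenomena.Ising3DConformalLimit.SubPtolemyFloorStein

end
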